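import Mathlib
import Summits.MatrixMultiplication.MatrixMultiplication.Theses.FidelityWitnesses
import Summits.MatrixMultiplication.MatrixMultiplication.Theorems.FidelityWitnessesFidelityGapTwoSixConeClosure
import Literature.Computability.AlgebraicComplexity.AsymptoticRankZariskiClosedProofs
import Literature.Computability.AlgebraicComplexity.BorderRankLimit
import Literature.Computability.AlgebraicComplexity.AlderStrassenProofs
import Literature.Computability.AlgebraicComplexity.BorderRankMatMulSmall

/-!
# `FidelityWitnesses.FidelityGapThreeSixteen` (stmt-MatrixMultiplication-4963) — reduction to `17 ≤ R̲(⟨3,3,3⟩)`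

The support item `∃ ε > 0, ∀ S (tensorRank S ≤ 16), ‖Σ S·⟨3,3,3⟩‖² ≤ (1 − ε)·27·Σ‖S‖²` of route
`MatrixMultiplication/FidelityWitnesses` is the metric shadow of a border-rank statement.  This file
PROVES the reduction

* `fidelityGapThreeSixteen_iff_seventeen_le_algBorderRank :
    FidelityGapThreeSixteen ↔ 17 ≤ algBorderRank (matMulTensor ℂ 3 3 3)`

(continuity of the fidelity functional for `→`'s contrapositive; the closure criterion for a complex
cone `stub_coneClosure` for the hard half; Alder's theorem
`alder_secantVariety_eq_setOf_algBorderRank_le_holds` — Zariski = Euclidean closure of the rank locus,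
equal to `{R̲ ≤ r}` — to pass between "not a limit of rank-`≤ 16` tensors" and `16 < R̲`), and records
the conditional closure

* `fidelityGapThreeSixteen_of_CHL : ConnerHarperLandsberg2023_thm_1_1 → FidelityGapThreeSixteen`

from the named fact `ConnerHarperLandsberg2023_thm_1_1 : 17 ≤ algBorderRank (matMulTensor ℂ 3 3 3)`
(A. Conner, A. Harper, J. M. Landsberg, Forum Math. Pi 11 (2023) e17, Thm. 1.1, border apolarity;
vendored in `Literature/Computability/AlgebraicComplexity/BorderRankMatMulSmall.lean`, NOT yet
discharged in the tree — the tree proves `16 ≤ R̲(⟨3,3,3⟩)`, Landsberg–Michałek).  By the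
equivalence the item is EXACTLY that fact: it closes unconditionally the moment
`ConnerHarperLandsberg2023_thm_1_1` is discharged, and not before.
-/

-- single-conjunct summit: `Summit.<S>.<P>` has `<P> = <S>`, the deliberate duplicate the layout mandates
set_option linter.dupNamespace false

namespace Summit.MatrixMultiplication.MatrixMultiplication.Theorems

open scoped BigOperators ComplexConjugate
open Literature.Computability.AlgebraicComplexity
open Summit.MatrixMultiplication.MatrixMultiplication.Theses.FidelityWitnesses (FidelityGapThreeSixteen)

/-- `Σ_{abc} ⟨n,n,n⟩_{abc} = n³` over any commutative ring (the tensor has `n³` ones). [folklore] -/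
theorem fidelityGapThreeSixteen_sum_matMulTensor (K : Type) [CommRing K] (n : ℕ) :
    (∑ a : Fin n × Fin n, ∑ b : Fin n × Fin n, ∑ c : Fin n × Fin n,
      matMulTensor K n n n a b c) = (n : K) ^ 3 := by
  have h1 : ∀ a b : Fin n × Fin n,
      (∑ c : Fin n × Fin n, matMulTensor K n n n a b c) = if a.1 = b.1 then 1 else 0 := by
    intro a b
    by_cases hab : a.1 = b.1
    · rw [if_pos hab, Finset.sum_eq_single (b.2, a.2)]
      · simp [matMulTensor, hab]
      · intro c _ hc
        simp only [matMulTensor]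
        rw [if_neg]
        rintro ⟨-, h2, h3⟩
        exact hc (Prod.ext h2.symm h3.symm)
      · intro h
        exact absurd (Finset.mem_univ _) h
    · rw [if_neg hab]
      exact Finset.sum_eq_zero fun c _ => by
        simp [matMulTensor, hab]
  have h2 : ∀ a : Fin n × Fin n, (∑ b : Fin n × Fin n, if a.1 = b.1 then (1 : K) else 0) = n := by
    intro a
    rw [Fintype.sum_prod_type, Finset.sum_comm]
    simp
  simp_rw [h1, h2]
  simp [Finset.sum_const, Finset.card_univ, Fintype.card_prod, Fintype.card_fin]
  ring

/-- `‖⟨3,3,3⟩‖² = 27` (coordinate `ℓ²` sum). [folklore] -/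
theorem fidelityGapThreeSixteen_normSq_matMulTensor_three :
    (∑ a : Fin 3 × Fin 3, ∑ b : Fin 3 × Fin 3, ∑ c : Fin 3 × Fin 3,
      ‖matMulTensor ℂ 3 3 3 a b c‖ ^ 2) = (27 : ℝ) := by
  have h : ∀ a b c : Fin 3 × Fin 3,
      ‖matMulTensor ℂ 3 3 3 a b c‖ ^ 2 = matMulTensor ℝ 3 3 3 a b c := by
    intro a b c
    simp only [matMulTensor]
    split_ifs <;> simp
  simp_rw [h]
  rw [fidelityGapThreeSixteen_sum_matMulTensor ℝ 3]
  norm_num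

/-- The self-overlap `Σ ⟨3,3,3⟩·⟨3,3,3⟩ = 27` (complex). [folklore] -/
theorem fidelityGapThreeSixteen_overlap_self :
    (∑ a : Fin 3 × Fin 3, ∑ b : Fin 3 × Fin 3, ∑ c : Fin 3 × Fin 3,
      matMulTensor ℂ 3 3 3 a b c * matMulTensor ℂ 3 3 3 a b c) = (27 : ℂ) := by
  have h : ∀ a b c : Fin 3 × Fin 3,
      matMulTensor ℂ 3 3 3 a b c * matMulTensor ℂ 3 3 3 a b c = matMulTensor ℂ 3 3 3 a b c := by
    intro a b c
    simp only [matMulTensor]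
    split_ifs <;> simp
  simp_rw [h]
  rw [fidelityGapThreeSixteen_sum_matMulTensor ℂ 3]
  norm_num

/-- Sesquilinear and bilinear overlaps with the real tensor `⟨3,3,3⟩` have the same norm.
[folklore] -/
theorem fidelityGapThreeSixteen_norm_overlap_conj
    (S : (Fin 3 × Fin 3) → (Fin 3 × Fin 3) → (Fin 3 × Fin 3) → ℂ) :
    ‖∑ a, ∑ b, ∑ c, (starRingEnd ℂ) (S a b c) * matMulTensor ℂ 3 3 3 a b c‖ =
      ‖∑ a, ∑ b, ∑ c, S a b c * matMulTensor ℂ 3 3 3 a b c‖ := by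
  have hc : ∀ a b c : Fin 3 × Fin 3,
      (starRingEnd ℂ) (matMulTensor ℂ 3 3 3 a b c) = matMulTensor ℂ 3 3 3 a b c := by
    intro a b c
    unfold matMulTensor
    split_ifs <;> simp
  have h : (∑ a, ∑ b, ∑ c, (starRingEnd ℂ) (S a b c) * matMulTensor ℂ 3 3 3 a b c)
      = (starRingEnd ℂ) (∑ a, ∑ b, ∑ c, S a b c * matMulTensor ℂ 3 3 3 a b c) := by
    simp only [map_sum, map_mul, hc]
  rw [h, Complex.norm_conj]

/-- **Easy half (continuity)**: if `⟨3,3,3⟩` is a limit of tensors of rank `≤ 16` there is no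
fidelity gap at `(3, 16)` — the strict inequality `(1-ε)·27·‖S‖² < |⟨S,⟨3,3,3⟩⟩|²` holds at
`S = ⟨3,3,3⟩` (`729(1-ε) < 729`) and is an open condition. [folklore] -/
theorem fidelityGapThreeSixteen_false_of_mem_closure
    (h : matMulTensor ℂ 3 3 3 ∈ closure
      {S : (Fin 3 × Fin 3) → (Fin 3 × Fin 3) → (Fin 3 × Fin 3) → ℂ | tensorRank S ≤ 16}) :
    ¬ FidelityGapThreeSixteen := by
  rintro ⟨ε, hε, hgap⟩
  set f : ((Fin 3 × Fin 3) → (Fin 3 × Fin 3) → (Fin 3 × Fin 3) → ℂ) → ℝ := fun S =>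
    ‖∑ a, ∑ b, ∑ c, S a b c * matMulTensor ℂ 3 3 3 a b c‖ ^ 2 -
      (1 - ε) * 27 * ∑ a, ∑ b, ∑ c, ‖S a b c‖ ^ 2 with hf
  have hcont : Continuous f := by
    simp only [hf]
    fun_prop
  have hopen : IsOpen (f ⁻¹' Set.Ioi 0) := hcont.isOpen_preimage _ isOpen_Ioi
  have hT : matMulTensor ℂ 3 3 3 ∈ f ⁻¹' Set.Ioi 0 := by
    simp only [Set.mem_preimage, Set.mem_Ioi, hf, fidelityGapThreeSixteen_overlap_self,
      fidelityGapThreeSixteen_normSq_matMulTensor_three]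
    have : ‖(27 : ℂ)‖ = 27 := by
      rw [show (27 : ℂ) = ((27 : ℝ) : ℂ) by norm_num, Complex.norm_real]
      norm_num
    rw [this]
    nlinarith
  obtain ⟨S, hSU, hSC⟩ := mem_closure_iff.1 h _ hopen hT
  have h1 := hgap S hSC
  simp only [Set.mem_preimage, Set.mem_Ioi, hf] at hSU
  linarith

/-- **Hard half (cone criterion `stub_coneClosure`)**: if `⟨3,3,3⟩` is not a limit of tensors of
rank `≤ 16`, a uniform fidelity gap exists (the rank-`≤ 16` tensors form a complex cone,
`tensorRank_smul_le`). [folklore] -/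
theorem fidelityGapThreeSixteen_of_notMem_closure
    (h : matMulTensor ℂ 3 3 3 ∉ closure
      {S : (Fin 3 × Fin 3) → (Fin 3 × Fin 3) → (Fin 3 × Fin 3) → ℂ | tensorRank S ≤ 16}) :
    FidelityGapThreeSixteen := by
  by_contra hgap
  refine h (stub_coneClosure _ (fun c S hS => ?_) _ fun ε hε => ?_)
  · show tensorRank (c • S) ≤ 16
    exact (tensorRank_smul_le c S).trans hS
  · unfold FidelityGapThreeSixteen at hgap
    push Not at hgap
    obtain ⟨S, hS, hlt⟩ := hgap ε hε
    refine ⟨S, hS, ?_⟩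
    rw [fidelityGapThreeSixteen_norm_overlap_conj, fidelityGapThreeSixteen_normSq_matMulTensor_three]
    have hcomm : (1 - ε) * (∑ a, ∑ b, ∑ c, ‖S a b c‖ ^ 2) * 27
        = (1 - ε) * 27 * ∑ a, ∑ b, ∑ c, ‖S a b c‖ ^ 2 := by ring
    rw [hcomm]
    exact hlt

/-- **The item is exactly `17 ≤ R̲(⟨3,3,3⟩)`** (witness theorem at `(3,16)` + Alder's theorem,
both proved in the tree): `FidelityGapThreeSixteen ↔ 17 ≤ algBorderRank (matMulTensor ℂ 3 3 3)`.
[folklore] -/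
theorem fidelityGapThreeSixteen_iff_seventeen_le_algBorderRank :
    FidelityGapThreeSixteen ↔ 17 ≤ algBorderRank (matMulTensor ℂ 3 3 3) := by
  have key : FidelityGapThreeSixteen ↔ matMulTensor ℂ 3 3 3 ∉ closure
      {S : (Fin 3 × Fin 3) → (Fin 3 × Fin 3) → (Fin 3 × Fin 3) → ℂ | tensorRank S ≤ 16} :=
    ⟨fun hg hmem => fidelityGapThreeSixteen_false_of_mem_closure hmem hg,
      fidelityGapThreeSixteen_of_notMem_closure⟩
  rw [key, mem_closure_setOf_tensorRank_le_iff alder_secantVariety_eq_setOf_algBorderRank_le_holds,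
    not_le]
  exact Nat.lt_iff_add_one_le

/-- **Conditional closure of the item**: the named fact `ConnerHarperLandsberg2023_thm_1_1`
(`17 ≤ R̲(⟨3,3,3⟩)`, Conner–Harper–Landsberg 2023, Thm. 1.1 — border apolarity; vendored, not yet
discharged in the tree) gives `FidelityGapThreeSixteen`.  CONDITIONAL on that fact (hypothesis `h`).
[cite: ConnerHarperLandsberg2023, Thm. 1.1] -/
theorem fidelityGapThreeSixteen_of_CHL (h : ConnerHarperLandsberg2023_thm_1_1) :
    FidelityGapThreeSixteen :=
  fidelityGapThreeSixteen_iff_seventeen_le_algBorderRank.2 h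

end Summit.MatrixMultiplication.MatrixMultiplication.Theorems
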